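import Summits.QuantumFields.YangMills.Theorems.SwapVirialDeficitBlowUpGnomonicStratumBHubPolar
import HarnessLib

/-!
# THE JOINT B-FIBRE FLOOR (hub-polar δ AND the letters in ONE Hessian inequality): along `s ↦ (a − (sδ)·1, η_B + s·ξ_B(d))`
# (free-hands support of ⟨stmt-QuantumFields-24197⟩ `SwapVirialDeficit.SwapGluedStiffness`; stub (S-B) `stub_B_stiff` of LEAD g98's plan of record memo7 §E(3):
# «δ-in-fibre fibred lemma» needs the quadratic form of fibre_B = (δ, x₀′, y′, z′, η_F′) bounded below along EVERY joint ray — this file gives the hub∕y∕z∕follower∕cross part;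
# the x₀′ seam part along the joint ray is the sequel)

The three touching minorants of ✓`fibre_raySecond_ge_stratumB_eta` hold pointwise for EVERY hub, in particular for the shifted hub `a(s) = a − (sδ)·1`; along the shift
`(2A₀A₁)²(s) = s²·4δ²‖im a‖²/((sδ)²+‖im a‖²)²` (✓`hubStiff_hubShift_eq`) and `A₁(s)² = ‖im a‖²/((sδ)²+‖im a‖²)` (`hubA1_sq_hubShift_eq`), so the hub minorant now also carries the
`δ²`-term of ✓`fibre_raySecond_ge_stratumB_hubPolar`:
* ★★★ `fibre_raySecond_ge_stratumB_joint (ha : a.im ≠ 0) (hre : a.re = 0) (ε) (hz) (hε) (u₁ u₂ δ d)`: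
  `(2/3)·[ ((4δ²/‖im a‖²)·4|u|²/(1+|u|²) + 4(y₁′²+y₂′²) + 4|z′|²)/16200L⁶ + 2Σ_f|η_f′|²/(2304L⁶|Fol L|) + ((u₁y₂′−u₂y₁′)² + (u₂y₀′)² + (u₁y₀′)²)/(450L⁶(1+|u|²)) ]
   ≤ iteratedDeriv 2 (s ↦ F̂(a − (sδ)·1, ε, η_B + s·ξ_B(d))) 0`.

HONEST LABEL: composition of landed inequalities + one-variable calculus; stubs of ➎, ⟨24197⟩ ∕ ⟨24194⟩ ∕ ⟨24497⟩ OPEN; own crux ⟨22884⟩ OPEN (blocked-on ⟨19935⟩); the Yang–Mills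
mass gap is NOT proved; no summit is proved by a line.  THEOREMS ONLY (0 `def`, 0 `sorry`), standard axioms.  Width seat ym-line-sfw-p2-w3 g66 (cell ym-idea-1, free hands),
`--supports stmt-QuantumFields-24197`.  References: [cite: Luscher1983, §2]; [folklore].
-/

set_option autoImplicit false

noncomputable section

open MeasureTheory Quaternion
open scoped BigOperators Quaternion ContDiff
open Literature.MathematicalPhysics.QuantumFieldTheory hiding SU2
open Literature.MathematicalPhysics.QuantumLattice

namespace Summit.QuantumFields.YangMills.Theorems.SwapVirialDeficit.BlowUpRing

open Summit.QuantumFields.YangMills.Theorems.FemtoTransferGap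
open Summit.QuantumFields.YangMills.Theorems.FemtoTransferGap.TT
open Summit.QuantumFields.YangMills.Theorems.VirialFluxGap.RingDeficit
open Summit.QuantumFields.YangMills.Theorems.SwapVirialDeficit.SwapRing
open Summit.QuantumFields.YangMills.Theorems.SwapVirialDeficit.Gnomonic (normSq3 normSq3_nonneg gnomonicW gnomonicW_nonneg_le contDiff_gnoDeficit_hubShift_ray
  im_sub_smul_one sub_smul_one_ne_zero)
open Summit.QuantumFields.YangMills.Theorems.QuantitativeLaplace (iteratedDeriv_two_ge_of_three_minorants iteratedDeriv_two_sq_mul contDiff_sq_mul)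

variable {L : ℕ} [NeZero L]

omit [NeZero L] in
/-- `A₁(s)² = ‖im a‖²/((sδ)² + ‖im a‖²)` along the hub shift (`re a = 0`, `im a ≠ 0`). [folklore] -/
theorem hubA1_sq_hubShift_eq {a : ℍ} (ha : a.im ≠ 0) (hre : a.re = 0) (c : ℝ) :
    (‖a - c • (1 : ℍ)‖⁻¹ * ‖(a - c • (1 : ℍ)).im‖) ^ 2 = ‖a.im‖ ^ 2 / (c ^ 2 + ‖a.im‖ ^ 2) := by
  have hN : ‖a - c • (1 : ℍ)‖ ≠ 0 := norm_ne_zero_iff.2 (sub_smul_one_ne_zero ha c)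
  rw [im_sub_smul_one, ← normSq_hubShift hre c, mul_pow, inv_pow]
  field_simp

set_option maxHeartbeats 800000 in
/-- ★★★ **THE JOINT B-FIBRE FLOOR** (end hub `im a ≠ 0`, `re a = 0`; `ε_z = +`, followers `+`; base letter `u`; hub speed `δ`, letter direction `d`). [cite: Luscher1983, §2] -/
theorem fibre_raySecond_ge_stratumB_joint {a : ℍ} (ha : a.im ≠ 0) (hre : a.re = 0) (ε : GnoSign L) (hz : ε.2.1 = true) (hε : ε.2.2 = fun _ => true)
    (u₁ u₂ δ : ℝ) (d : ℝ × (Fin 3 → ℝ) × (Fin 3 → ℝ) × (Fol L → Fin 3 → ℝ)) :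
    2 / 3 * (((4 * δ ^ 2 / ‖a.im‖ ^ 2) * (4 * (u₁ ^ 2 + u₂ ^ 2) / (1 + (u₁ ^ 2 + u₂ ^ 2))) + 4 * (d.2.1 1 ^ 2 + d.2.1 2 ^ 2) + 4 * normSq3 d.2.2.1) /
          (16200 * (L : ℝ) ^ 6) +
        (∑ f, 2 * normSq3 (d.2.2.2 f)) / (2304 * (L : ℝ) ^ 6 * (Fintype.card (Fol L) : ℝ)) +
        ((u₁ * d.2.1 2 - u₂ * d.2.1 1) ^ 2 + (u₂ * d.2.1 0) ^ 2 + (u₁ * d.2.1 0) ^ 2) / (450 * (L : ℝ) ^ 6 * (1 + (u₁ ^ 2 + u₂ ^ 2)))) ≤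
      iteratedDeriv 2 (fun s : ℝ => gnoDeficit (fun _ => false) (fun _ => 1) (a - (s * δ) • (1 : ℍ)) ε
        (((((![0, u₁, u₂] : Fin 3 → ℝ), (0 : Fin 3 → ℝ)), ((0 : Fin 3 → ℝ), (0 : Fol L → Fin 3 → ℝ))) : GnoCoord L) +
          s • ((((![d.1, 0, 0] : Fin 3 → ℝ), d.2.1), (d.2.2.1, d.2.2.2)) : GnoCoord L))) 0 := by
  have hL : (0 : ℝ) < L := by exact_mod_cast NeZero.pos L
  have him : 0 < ‖a.im‖ := norm_pos_iff.2 ha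
  have ha0 : a ≠ 0 := by intro h; apply ha; rw [h]; rfl
  have hcard : 0 < (Fintype.card (Fol L) : ℝ) := by
    have h1 : 1 ≤ L := Nat.one_le_iff_ne_zero.2 (NeZero.ne L)
    have h4 : 1 ≤ L ^ 4 := Nat.one_le_pow _ _ h1
    have h : 0 < Fintype.card (Fol L) := by rw [card_fol]; omega
    exact_mod_cast h
  -- the three `h` functions
  set h₁ : ℝ → ℝ := fun s => ((4 * ‖a.im‖ ^ 2 / ((s * δ) ^ 2 + ‖a.im‖ ^ 2) ^ 2 * δ ^ 2) * (4 * (u₁ ^ 2 + u₂ ^ 2) / (1 + ((s * d.1) ^ 2 + (u₁ ^ 2 + u₂ ^ 2)))) +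
      (‖a.im‖ ^ 2 / ((s * δ) ^ 2 + ‖a.im‖ ^ 2)) * (4 * (d.2.1 1 ^ 2 + d.2.1 2 ^ 2) / (1 + s ^ 2 * normSq3 d.2.1)) +
      4 * normSq3 d.2.2.1 / (1 + s ^ 2 * normSq3 d.2.2.1)) / (16200 * (L : ℝ) ^ 6) with hh₁
  set h₂ : ℝ → ℝ := fun s => (∑ f, 2 * normSq3 (d.2.2.2 f) / (1 + s ^ 2 * normSq3 (d.2.2.2 f))) / (2304 * (L : ℝ) ^ 6 * (Fintype.card (Fol L) : ℝ)) with hh₂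
  set h₃ : ℝ → ℝ := fun s => ((u₁ * d.2.1 2 - u₂ * d.2.1 1) ^ 2 + (u₂ * d.2.1 0 - s * d.1 * d.2.1 2) ^ 2 + (s * d.1 * d.2.1 1 - u₁ * d.2.1 0) ^ 2) /
      (450 * (L : ℝ) ^ 6 * ((1 + (s ^ 2 * d.1 ^ 2 + (u₁ ^ 2 + u₂ ^ 2))) * (1 + s ^ 2 * normSq3 d.2.1))) with hh₃
  set φ : ℝ → ℝ := fun s : ℝ => gnoDeficit (fun _ => false) (fun _ => 1) (a - (s * δ) • (1 : ℍ)) ε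
      (((((![0, u₁, u₂] : Fin 3 → ℝ), (0 : Fin 3 → ℝ)), ((0 : Fin 3 → ℝ), (0 : Fol L → Fin 3 → ℝ))) : GnoCoord L) +
        s • ((((![d.1, 0, 0] : Fin 3 → ℝ), d.2.1), (d.2.2.1, d.2.2.2)) : GnoCoord L)) with hφ
  -- smoothness
  have hy1 := normSq3_nonneg d.2.1
  have hz1 := normSq3_nonneg d.2.2.1
  have hq : ∀ (c e : ℝ), 0 < c → 0 ≤ e → ContDiff ℝ ∞ fun s : ℝ => c + s ^ 2 * e := by
    intro c e _ _
    exact contDiff_const.add ((contDiff_id.pow 2).mul contDiff_const)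
  have hqne : ∀ (c e : ℝ), 0 < c → 0 ≤ e → ∀ s : ℝ, c + s ^ 2 * e ≠ 0 := by
    intro c e hc he s
    positivity
  have hp1 : ContDiff ℝ ∞ fun s : ℝ => (s * δ) ^ 2 + ‖a.im‖ ^ 2 := ((contDiff_id.mul contDiff_const).pow 2).add contDiff_const
  have hp1ne : ∀ s : ℝ, (s * δ) ^ 2 + ‖a.im‖ ^ 2 ≠ 0 := fun s => by positivity
  have hp1ne2 : ∀ s : ℝ, ((s * δ) ^ 2 + ‖a.im‖ ^ 2) ^ 2 ≠ 0 := fun s => by positivity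
  have hp2 : ContDiff ℝ ∞ fun s : ℝ => 1 + ((s * d.1) ^ 2 + (u₁ ^ 2 + u₂ ^ 2)) := contDiff_const.add (((contDiff_id.mul contDiff_const).pow 2).add contDiff_const)
  have hp2ne : ∀ s : ℝ, 1 + ((s * d.1) ^ 2 + (u₁ ^ 2 + u₂ ^ 2)) ≠ 0 := fun s => by positivity
  have hh₁d : ContDiff ℝ ∞ h₁ := by
    refine ContDiff.div_const ?_ _
    refine ((((contDiff_const.div (hp1.pow 2) hp1ne2).mul contDiff_const).mul (contDiff_const.div hp2 hp2ne)).add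
      ((contDiff_const.div hp1 hp1ne).mul (contDiff_const.div (hq _ _ one_pos hy1) (hqne _ _ one_pos hy1)))).add
      (contDiff_const.div (hq _ _ one_pos hz1) (hqne _ _ one_pos hz1))
  have hh₂d : ContDiff ℝ ∞ h₂ := by
    refine ContDiff.div_const ?_ _
    exact ContDiff.sum fun f _ => contDiff_const.div (hq _ _ one_pos (normSq3_nonneg _)) (hqne _ _ one_pos (normSq3_nonneg _))
  have hh₃d : ContDiff ℝ ∞ h₃ := by
    have hnum : ContDiff ℝ ∞ fun s : ℝ => (u₁ * d.2.1 2 - u₂ * d.2.1 1) ^ 2 + (u₂ * d.2.1 0 - s * d.1 * d.2.1 2) ^ 2 +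
        (s * d.1 * d.2.1 1 - u₁ * d.2.1 0) ^ 2 :=
      (contDiff_const.add ((contDiff_const.sub ((contDiff_id.mul contDiff_const).mul contDiff_const)).pow 2)).add
        ((((contDiff_id.mul contDiff_const).mul contDiff_const).sub contDiff_const).pow 2)
    have hden : ContDiff ℝ ∞ fun s : ℝ => 450 * (L : ℝ) ^ 6 * ((1 + (s ^ 2 * d.1 ^ 2 + (u₁ ^ 2 + u₂ ^ 2))) * (1 + s ^ 2 * normSq3 d.2.1)) :=
      contDiff_const.mul ((contDiff_const.add (((contDiff_id.pow 2).mul contDiff_const).add contDiff_const)).mul (hq _ _ one_pos hy1))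
    refine hnum.div hden fun s => ?_
    positivity
  have hφd : ContDiff ℝ ∞ φ := contDiff_gnoDeficit_hubShift_ray (L := L) (fun _ => false) (fun _ => 1) ha ε δ _ _ (n := ⊤)
  -- touching at the B point
  have hφ0 : φ 0 = 0 := by
    simp only [hφ, zero_mul, zero_smul, sub_zero, add_zero]
    exact gnoDeficit_stratumB_eq_zero ha0 hre ε hz hε u₁ u₂
  -- minorant 1: the hub floor along the shifted hub
  have hm1 : ∀ s, s ^ 2 * h₁ s ≤ φ s := by
    intro s
    have has : (a - (s * δ) • (1 : ℍ)) ≠ 0 := sub_smul_one_ne_zero ha (s * δ)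
    have hfl := leadersW_hubStiff_le (L := L) has ε
      (((((![0, u₁, u₂] : Fin 3 → ℝ), (0 : Fin 3 → ℝ)), ((0 : Fin 3 → ℝ), (0 : Fol L → Fin 3 → ℝ))) : GnoCoord L) +
        s • ((((![d.1, 0, 0] : Fin 3 → ℝ), d.2.1), (d.2.2.1, d.2.2.2)) : GnoCoord L))
    obtain ⟨e1, e2, e3, -⟩ := stratumB_ray_letters (L := L) u₁ u₂ s (d := d)
    rw [e1, e2, e3, hubStiff_hubShift_eq ha hre, hubA1_sq_hubShift_eq ha hre, gnoWtr_smul_ray, gnomonicW_smul_ray] at hfl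
    have ew : gnoWtr ((![0, u₁, u₂] : Fin 3 → ℝ) + s • ![d.1, 0, 0]) = 4 * (u₁ ^ 2 + u₂ ^ 2) / (1 + ((s * d.1) ^ 2 + (u₁ ^ 2 + u₂ ^ 2))) := by
      simp only [gnoWtr, Fin.sum_univ_three, Pi.add_apply, Pi.smul_apply, smul_eq_mul, Matrix.cons_val_zero, Matrix.cons_val_one, Matrix.cons_val_two,
        Matrix.head_cons, Matrix.tail_cons, mul_zero, add_zero, zero_add]
      ring_nf
    rw [ew] at hfl
    have h16 : (0 : ℝ) < 16200 * (L : ℝ) ^ 6 := by positivity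
    show s ^ 2 * h₁ s ≤ gnoDeficit (fun _ => false) (fun _ => 1) (a - (s * δ) • (1 : ℍ)) ε _
    unfold gnoDeficit
    have key : s ^ 2 * h₁ s * (16200 * (L : ℝ) ^ 6) =
        (s * δ) ^ 2 * (4 * ‖a.im‖ ^ 2 / ((s * δ) ^ 2 + ‖a.im‖ ^ 2) ^ 2) * (4 * (u₁ ^ 2 + u₂ ^ 2) / (1 + ((s * d.1) ^ 2 + (u₁ ^ 2 + u₂ ^ 2)))) +
        ‖a.im‖ ^ 2 / ((s * δ) ^ 2 + ‖a.im‖ ^ 2) * (s ^ 2 * (4 * (d.2.1 1 ^ 2 + d.2.1 2 ^ 2) / (1 + s ^ 2 * normSq3 d.2.1))) +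
        s ^ 2 * (4 * normSq3 d.2.2.1 / (1 + s ^ 2 * normSq3 d.2.2.1)) := by
      simp only [hh₁]; field_simp
    have : s ^ 2 * h₁ s * (16200 * (L : ℝ) ^ 6) ≤ 16200 * (L : ℝ) ^ 6 * chartDeficit L (fun _ => false) (fun _ => 1)
        (blowUpPoint 1 (gnomonicPoint (a - (s * δ) • (1 : ℍ)) ε
          (((((![0, u₁, u₂] : Fin 3 → ℝ), (0 : Fin 3 → ℝ)), ((0 : Fin 3 → ℝ), (0 : Fol L → Fin 3 → ℝ))) : GnoCoord L) +
            s • ((((![d.1, 0, 0] : Fin 3 → ℝ), d.2.1), (d.2.2.1, d.2.2.2)) : GnoCoord L)))) := by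
      rw [key]; linarith only [hfl]
    nlinarith [this, h16]
  -- minorants 2, 3: followers and commutator, at the shifted hub
  have hm2 : ∀ s, s ^ 2 * h₂ s ≤ φ s := fun s => stratumB_follower_ray_minorant (L := L) ε u₁ u₂ (d := d) (a - (s * δ) • (1 : ℍ)) hε s
  have hm3 : ∀ s, s ^ 2 * h₃ s ≤ φ s := fun s => stratumB_cross_ray_minorant (L := L) ε u₁ u₂ (d := d) (a - (s * δ) • (1 : ℍ)) s
  -- comparison
  have key := iteratedDeriv_two_ge_of_three_minorants (φ := φ) (γ₁ := fun s => s ^ 2 * h₁ s) (γ₂ := fun s => s ^ 2 * h₂ s) (γ₃ := fun s => s ^ 2 * h₃ s)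
    hφd (contDiff_sq_mul hh₁d) (contDiff_sq_mul hh₂d) (contDiff_sq_mul hh₃d) hm1 hm2 hm3 (by simp [hφ0]) (by simp [hφ0]) (by simp [hφ0])
  have h2 : (2 : WithTop ℕ∞) ≤ ∞ := by norm_cast
  rw [iteratedDeriv_two_sq_mul (hh₁d.of_le h2), iteratedDeriv_two_sq_mul (hh₂d.of_le h2), iteratedDeriv_two_sq_mul (hh₃d.of_le h2)] at key
  have e1 : h₁ 0 = (((4 * δ ^ 2 / ‖a.im‖ ^ 2) * (4 * (u₁ ^ 2 + u₂ ^ 2) / (1 + (u₁ ^ 2 + u₂ ^ 2))) + 4 * (d.2.1 1 ^ 2 + d.2.1 2 ^ 2) + 4 * normSq3 d.2.2.1) /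
      (16200 * (L : ℝ) ^ 6)) := by
    simp only [hh₁, zero_mul, ne_eq, OfNat.ofNat_ne_zero, not_false_eq_true, zero_pow, zero_add, add_zero, div_one]
    have him2 : ‖a.im‖ ^ 2 ≠ 0 := by positivity
    field_simp
  have e2 : h₂ 0 = (∑ f, 2 * normSq3 (d.2.2.2 f)) / (2304 * (L : ℝ) ^ 6 * (Fintype.card (Fol L) : ℝ)) := by simp [hh₂]
  have e3 : h₃ 0 = ((u₁ * d.2.1 2 - u₂ * d.2.1 1) ^ 2 + (u₂ * d.2.1 0) ^ 2 + (u₁ * d.2.1 0) ^ 2) / (450 * (L : ℝ) ^ 6 * (1 + (u₁ ^ 2 + u₂ ^ 2))) := by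
    simp [hh₃]
  rw [e1, e2, e3] at key
  linarith only [key]

end Summit.QuantumFields.YangMills.Theorems.SwapVirialDeficit.BlowUpRing

end
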